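import Summits.KontsevichZagierPeriods.KontsevichZagierPeriods.Theorems.RootDecompWalshStrataParab4Baker
import Summits.KontsevichZagierPeriods.KontsevichZagierPeriods.Theorems.RootDecompWalshStrataCone4Baker

/-!
# Accessible identities between different quadric 4-cells, exhibited inside the rules

Route `RootDecompWalshStrata` (cell decomp-kz, lens 4, gen 11), support toward `QuadricSignKernel`
(item stmt-KontsevichZagierPeriods-25393).  Conjecture 1 of Kontsevich–Zagier asks that two integral
representations of the SAME number be linked by the three rules.  The descents of this node make such
links EXPLICIT between genuinely different four-dimensional domains — no oracle, no transcendence input: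
* **«`π/4` two ways»**: `[(0,1)⁴ ∩ {x₃ > x₀²+x₁²+x₂²}, a] − [(0,1)⁴ ∩ {x₃² > x₀²+x₁²+x₂²}, b] ∈ KZ.relations`
  whenever `8a = 5b` (`parab_sub_cone_mem_relations`; volumes `π/15` and `π/24`), e.g. `a = 15/4`, `b = 6`:
  both cells descend to the SAME arc representation `[(0,1), w/(2((1−t)²+t²))]`;
* the same for every permuted copy of the paraboloid (`parab_rename_sub_cone_mem_relations`), via the
  explicit permutation identity `[cell(rename σ P), q] − [cell(P), q] ∈ KZ.relations`
  (`of_cellRep_rename_sub_mem_relations`, any dimension);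
* (weight two, part 73: `[(0,1)⁴ ∩ {Σxᵢ² < 1}, 2] − [Q]⊗[Q] ∈ KZ.relations`, `Q` the quarter disc.)
These are the non-formal instances of the kernel statements of parts 87–91 (a family supported on ONE
domain is formal by integrand additivity).  0 sorry.
[KontsevichZagier2001 §1.2 rules (1)–(3), §4.1; this node]
-/

noncomputable section

open Literature.NumberTheory.Transcendental
open MeasureTheory Set
open MvPolynomial (aeval X C rename)
open Summit.KontsevichZagierPeriods.RootDecompWalshStrata.WalshSpanProof (cellRep cellRep_domain
  cellRep_integrand)
open Summit.KontsevichZagierPeriods.RootDecompWalshStrata.Ball4 (arcRep)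
open Summit.KontsevichZagierPeriods.RootDecompWalshStrata.Parab4 (parab4Poly)
open Summit.KontsevichZagierPeriods.RootDecompWalshStrata.Cone4 (cone4Poly)
open Summit.KontsevichZagierPeriods.RootDecompWalshStrata.FourSym (reindex_cellRep_rename
  of_sub_of_cellRep_mem_relations)

namespace Summit.KontsevichZagierPeriods.RootDecompWalshStrata.Accessible

/-- **Explicit permutation identity:** `[cell(rename σ P), q] − [cell(P), q] ∈ KZ.relations` (rule (2)
with the coordinate permutation, `|det| = 1`, then rule (1b)). [KontsevichZagier2001 §1.2 rule (2)] -/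
theorem of_cellRep_rename_sub_mem_relations {N : ℕ} (σ : Equiv.Perm (Fin N))
    (P : MvPolynomial (Fin N) ℚ) (q : ℚ) :
    KZ.of (cellRep (rename σ P) q) - KZ.of (cellRep P q) ∈ KZ.relations := by
  set r := cellRep (rename σ P) q with hr
  have hperm : KZ.of r - KZ.of (r.reindex σ.symm) ∈ KZ.relations :=
    KZ.permRel_subset_relations (KZ.of_sub_of_reindex_mem_permRel r σ.symm)
  have hcell : KZ.of (r.reindex σ.symm) - KZ.of (cellRep P q) ∈ KZ.relations :=
    of_sub_of_cellRep_mem_relations P q _ (reindex_cellRep_rename σ P q)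
  have : KZ.of r - KZ.of (cellRep P q) =
      (KZ.of r - KZ.of (r.reindex σ.symm)) + (KZ.of (r.reindex σ.symm) - KZ.of (cellRep P q)) := by
    abel
  rw [this]
  exact add_mem hperm hcell

/-- **«`π/4` two ways», inside the rules:** the paraboloid cell with weight `a` and the cone cell with
weight `b` are linked by the three rules whenever `8a = 5b` — both descend to the arc representation
`[(0,1), w/(2((1−t)²+t²))]` with the same `w = 4a/15 = b/6`. [KontsevichZagier2001 §1.2; this node] -/
theorem parab_sub_cone_mem_relations {a b : ℚ} (h : 8 * a = 5 * b) :
    KZ.of (cellRep parab4Poly a) - KZ.of (cellRep cone4Poly b) ∈ KZ.relations := by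
  have h1 := Parab4.of_cell_sub_of_arcRep_mem_relations a
  have h2 := Cone4.of_cell_sub_of_arcRep_mem_relations b
  have e : 4 * a / 15 = b / 6 := by
    field_simp
    linarith
  rw [e] at h1
  simpa only [sub_sub_sub_cancel_right] using sub_mem h1 h2

/-- The instance `a = 15/4`, `b = 6` (common value `π/4`). [KontsevichZagier2001 §1.2; this node] -/
theorem parab_sub_cone_mem_relations_inst :
    KZ.of (cellRep parab4Poly (15 / 4)) - KZ.of (cellRep cone4Poly 6) ∈ KZ.relations :=
  parab_sub_cone_mem_relations (by norm_num)

/-- **Every permuted paraboloid cell against the cone cell** (`8a = 5b`).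
[KontsevichZagier2001 §1.2; this node] -/
theorem parab_rename_sub_cone_mem_relations (σ : Equiv.Perm (Fin 4)) {a b : ℚ} (h : 8 * a = 5 * b) :
    KZ.of (cellRep (rename σ parab4Poly) a) - KZ.of (cellRep cone4Poly b) ∈ KZ.relations := by
  have h1 := of_cellRep_rename_sub_mem_relations σ parab4Poly a
  have h2 := parab_sub_cone_mem_relations h
  have : KZ.of (cellRep (rename σ parab4Poly) a) - KZ.of (cellRep cone4Poly b) =
      (KZ.of (cellRep (rename σ parab4Poly) a) - KZ.of (cellRep parab4Poly a)) +
        (KZ.of (cellRep parab4Poly a) - KZ.of (cellRep cone4Poly b)) := by abel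
  rw [this]
  exact add_mem h1 h2

/-- **Two permuted copies of the cone cell** with the same weight are linked by the rules.
[KontsevichZagier2001 §1.2 rule (2); this node] -/
theorem cone_rename_sub_cone_rename_mem_relations (σ τ : Equiv.Perm (Fin 4)) (q : ℚ) :
    KZ.of (cellRep (rename σ cone4Poly) q) - KZ.of (cellRep (rename τ cone4Poly) q) ∈ KZ.relations := by
  simpa only [sub_sub_sub_cancel_right] using
    sub_mem (of_cellRep_rename_sub_mem_relations σ cone4Poly q)
      (of_cellRep_rename_sub_mem_relations τ cone4Poly q)

end Summit.KontsevichZagierPeriods.RootDecompWalshStrata.Accessible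

end
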